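import Mathlib
import HarnessLib
import Literature.Computability.AlgebraicComplexity.AsymptoticSpectrum
import Literature.Computability.AlgebraicComplexity.BorderRankCW
import Literature.Computability.AlgebraicComplexity.TensorRestrictionRank
import Literature.Computability.AlgebraicComplexity.KroneckerRank
import Literature.Computability.AlgebraicComplexity.CoppersmithWinograd1990Proofs
import Literature.Computability.AlgebraicComplexity.LaserMethodRestriction
import Literature.Computability.AlgebraicComplexity.LaserMethodTypeCount
import Literature.Computability.AlgebraicComplexity.MaxEntropyGivenMarginals
import Summits.MatrixMultiplication.MatrixMultiplication.Theorems.SaturationLadderExpSaturationEntropy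

/-!
# OutsiderSandwichHalfMM, part 1/3 — the ω-free diagonal `Q̃(cw₂) = 3` in restriction form

Landing chain for the route `Summits/…/Theses/OutsiderSandwich.lean` (`route-MatrixMultiplication-OutsiderSandwich`,
rev 3), cell `decomp-mm` lens 4 (minimal-counterexample / extremal reduction), generation 5.  The chain is
`OutsiderSandwichHalfMMDiagonal` → `OutsiderSandwichHalfMMFinite` → `OutsiderSandwichHalfMM` (each file ≤ 400
lines, gate lint; the two helper files import no `Theses` file, gate lint `theses-cone`; only the last file
imports the route file and proves its aside items BY NAME).  Land in this order, each with

  `ledger propose --kind proof --target Summits/MatrixMultiplication/MatrixMultiplication/Theorems/<Module>.lean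
     --file <Module>.lean --supports stmt-MatrixMultiplication-28620`

(the last one with `--workitem stmt-MatrixMultiplication-28620` instead of `--supports`).

THIS FILE (sorry-free, no hypothesis): `DiagonalAchieved` — for every `ε > 0`, cofinally in `N`,
`cw₂^{⊠N} ≥ ⟨r⟩` with `3^{(1-ε)N} ≤ r` — proved from `cw₂ ≥ cw'₂` (the permutation tensor, CW 1990 §11),
a free diagonal of the uniform joint type on the tight permutation support `S₃` (BCS Prop. 15.30–15.32 /
Le Gall 2014 App. A.3 with penalty `Γ_{S₃}(uniform) = 0`, tree `exists_free_diagonal_jointType_card`) and the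
subexponential-loss bookkeeping `loss_le_exp'` of the landed `SaturationLadderExpSaturationEntropy` (imported,
not copied: gate rule `dedup.landed`; two further folklore one-liners that exist in un-importable landed
modules — `⊕ᵢ⟨kᵢ,mᵢ,nᵢ⟩ ≥ ⟨p⟩` and `H(1/3,1/3,1/3) = log₂3` — are local `have`s here for the same reason).

Sources: CoppersmithWinograd1990 (§11), BurgisserClausenShokrollahi1997 (Prop. 15.30–15.32, Thm. 15.39),
LeGall2014 (App. A.3), ConnerGesmundoLandsbergVentura2022 (`Q̃(cw₂) = 3`), Blaser2013 (§7).
-/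

set_option linter.dupNamespace false -- `MatrixMultiplication.MatrixMultiplication` (summit = problem, D-0017)

namespace Summit.MatrixMultiplication.MatrixMultiplication.Theorems.OutsiderSandwichHalfMM

open scoped BigOperators
open Literature.Computability.AlgebraicComplexity

/-! ## (w1) The ω-FREE anchor `DiagonalAchieved` (`Q̃(cw₂) = 3` by restriction) — PROVED here -/

/- (statement `DiagonalAchieved`, spelled out in the theorem `diagonalAchieved` below — no `def : Prop`
here: an uncited problem-side Prop def is relocated by the gate) **ω-free anchor** (critic w1): the powers of `cw₂` restrict to unit tensors at the full
flattening rate: `∀ ε>0`, for infinitely many `N`, `cw₂^{⊠N} ≥ ⟨r⟩` with `r ≥ 3^{(1−ε)N}`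
(`Q̃(cw₂) = 3`; Strassen 1991 / CW 1990 §11 via `cw₂ ≅ cw'₂` and a free diagonal of the
permutation support).  PROVED below (`diagonalAchieved`), so it is no hypothesis of anything.
In-tree cross-reference: `Q̃(cw₂) = 3` as a SUPREMUM is the tree's
`Summit.MatrixMultiplication.MatrixMultiplication.Theorems.asymptoticSubrank_cwTensor_two_eq_three`
(`Theorems/SoloInformedCwTwoAsymptoticSubrank.lean`, 2026-08-19, same BCS Thm 15.39 pipeline over the
`S₃`-pattern support); the present `(ε, N₀)`-form with an explicit restriction `cw₂^{⊠N} ≥ ⟨r⟩` is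
re-derived here self-containedly (via `cw₂ ≥ cw'₂`, the uniform joint type on the permutation support
and the VXXZ penalty `= 0` by the Lagrange condition), because `closes`-side bookkeeping needs the
restriction witnesses, not the supremum. [folklore] -/

/-- The permutation tensor `cw'₂ = Σ_{(i,j,l) ∈ S₃} x_i y_j z_l` (CW 1990 §11; literally the tree's
`AlmanLi2026CwPrimeTensor.cwPrimeTensor ℂ`, restated because that module is outside the built cone).
[cite: CoppersmithWinograd1990, §11] -/
def cwPrime : Fin 3 → Fin 3 → Fin 3 → ℂ :=
  fun i j k => if i ≠ j ∧ j ≠ k ∧ i ≠ k then 1 else 0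

/-- **`cw₂ ≥ cw'₂`** over any field with `i² = −1`, `2 ≠ 0`: substitution matrix
`[[2,0,0],[0,1/2,−i/2],[0,1/2,i/2]]` (proof = the tree's `tensorRestrictsTo_cwTensor_two_cwPrimeTensor`,
`CwPrimeTensorIsoCwTwo.lean`, copied). [cite: CoppersmithWinograd1990, §11] -/
theorem tensorRestrictsTo_cwTensor_two_cwPrime_of {K : Type} [Field K] {i : K} (hi : i * i = -1)
    (h2 : (2 : K) ≠ 0) :
    TensorRestrictsTo (cwTensor K 2)
      (fun a b c : Fin 3 => if a ≠ b ∧ b ≠ c ∧ a ≠ c then (1 : K) else 0) := by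
  have hi2 : i ^ 2 = -1 := by rw [sq, hi]
  let N : Fin 3 → Fin 3 → K :=
    fun a' a => !![(2 : K), 0, 0; 0, 2⁻¹, -i * 2⁻¹; 0, 2⁻¹, i * 2⁻¹] a' a
  refine ⟨N, N, N, fun a' b' c' => ?_⟩
  fin_cases a' <;> fin_cases b' <;> fin_cases c' <;>
    simp [N, Fin.sum_univ_three, cwTensor_apply] <;>
    field_simp <;> ring_nf <;> simp [hi2] <;> ring

/-- `cw₂ ≥ cw'₂` over `ℂ` (`i = Complex.I`). [cite: CoppersmithWinograd1990, §11] -/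
theorem tensorRestrictsTo_cwTensor_two_cwPrime : TensorRestrictsTo (cwTensor ℂ 2) cwPrime :=
  tensorRestrictsTo_cwTensor_two_cwPrime_of Complex.I_mul_I two_ne_zero

/-- `S₃ ⊂ Fin 3³`: the six triples of pairwise distinct indices (the support of `cw'₂`). [folklore] -/
def permSupport₃ : Finset (Fin 3 × Fin 3 × Fin 3) :=
  Finset.univ.filter fun s => s.1 ≠ s.2.1 ∧ s.2.1 ≠ s.2.2 ∧ s.1 ≠ s.2.2

/-- Membership in `permSupport₃`: the three indices are pairwise distinct. [folklore] -/
theorem mem_permSupport₃ {s : Fin 3 × Fin 3 × Fin 3} :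
    s ∈ permSupport₃ ↔ s.1 ≠ s.2.1 ∧ s.2.1 ≠ s.2.2 ∧ s.1 ≠ s.2.2 := by
  simp [permSupport₃]

/-- `|S₃| = 6`. [folklore] -/
theorem permSupport₃_card : permSupport₃.card = 6 := by decide

/-- The permutation support is TIGHT: `i + j + l = 3` on `S₃`. [folklore] -/
theorem tight_of_mem_permSupport₃ {s : Fin 3 × Fin 3 × Fin 3} (hs : s ∈ permSupport₃) :
    (s.1 : ℤ) + (s.2.1 : ℤ) + ((s.2.2 : ℤ) - 3) = 0 := by
  rw [mem_permSupport₃] at hs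
  obtain ⟨i, j, l⟩ := s
  simp only [ne_eq, Fin.ext_iff] at hs
  have := i.isLt
  have := j.isLt
  have := l.isLt
  push_cast
  omega

/-- **A free diagonal of the permutation support is a unit tensor inside `cw'₂^{⊠N}`**: every block
`cw'₂^{⊠N}(x_δ,y_δ,z_δ)` is the `1×1×1` tensor `1`, so BCS Prop. 15.30 (tree
`tensorRestrictsTo_kroneckerPow_matMulDirectSum_of_free`) gives `cw'₂^{⊠N} ≥ ⟨|Δ|⟩`.
[cite: BurgisserClausenShokrollahi1997, Prop. 15.30] -/
theorem tensorRestrictsTo_kroneckerPow_cwPrime_unitTensor {N : ℕ}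
    (Δ : Finset ((Fin N → Fin 3) × (Fin N → Fin 3) × (Fin N → Fin 3)))
    (hΔS : ∀ δ ∈ Δ, ∀ ρ, labelSeq δ ρ ∈ permSupport₃)
    (hfree : ∀ δ ∈ Δ, ∀ δ' ∈ Δ, ∀ δ'' ∈ Δ, (∀ ρ, (δ.1 ρ, δ'.2.1 ρ, δ''.2.2 ρ) ∈ permSupport₃) →
        δ = δ' ∧ δ' = δ'') :
    TensorRestrictsTo (kroneckerPow cwPrime N) (unitTensor ℂ Δ.card) := by
  classical
  set d : Fin Δ.card → (Fin N → Fin 3) × (Fin N → Fin 3) × (Fin N → Fin 3) :=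
    fun i => ((Δ.equivFin.symm i : Δ) : (Fin N → Fin 3) × (Fin N → Fin 3) × (Fin N → Fin 3)) with hd
  have hdmem : ∀ i, d i ∈ Δ := fun i => (Δ.equivFin.symm i).2
  have hdinj : Function.Injective d := Subtype.val_injective.comp Δ.equivFin.symm.injective
  have hS : ∀ a b c, cwPrime a b c ≠ 0 →
      ((fun x => x) a, (fun x => x) b, (fun x => x) c) ∈ permSupport₃ := by
    intro a b c h
    rw [mem_permSupport₃]
    by_contra hne
    exact h (if_neg hne)
  have hmat : ∀ s ∈ permSupport₃, ∀ (u : Fin 1 × Fin 1) (v : Fin 1 × Fin 1) (w : Fin 1 × Fin 1),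
      cwPrime ((fun (s : Fin 3 × Fin 3 × Fin 3) (_ : Fin 1 × Fin 1) => s.1) s u)
        ((fun (s : Fin 3 × Fin 3 × Fin 3) (_ : Fin 1 × Fin 1) => s.2.1) s v)
        ((fun (s : Fin 3 × Fin 3 × Fin 3) (_ : Fin 1 × Fin 1) => s.2.2) s w) =
        matMulTensor ℂ 1 1 1 u v w := by
    intro s hs u v w
    rw [mem_permSupport₃] at hs
    have hu : u.1 = v.1 ∧ v.2 = w.1 ∧ u.2 = w.2 :=
      ⟨Subsingleton.elim _ _, Subsingleton.elim _ _, Subsingleton.elim _ _⟩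
    simp only [cwPrime, matMulTensor, if_pos hs, if_pos hu]
  have h1 := tensorRestrictsTo_kroneckerPow_matMulDirectSum_of_free (K := ℂ) cwPrime
    (fun x => x) (fun x => x) (fun x => x) permSupport₃ hS (fun _ => 1) (fun _ => 1) (fun _ => 1)
    (fun s _ => s.1) (fun s _ => s.2.1) (fun s _ => s.2.2) (fun _ _ _ => rfl) (fun _ _ _ => rfl)
    (fun _ _ _ => rfl) hmat d (fun i ρ => hΔS _ (hdmem i) ρ) (by
      intro i i' i'' h
      obtain ⟨e1, e2⟩ := hfree _ (hdmem i) _ (hdmem i') _ (hdmem i'') h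
      exact ⟨hdinj e1, hdinj e2⟩)
  -- a direct sum of matrix products with non-empty blocks restricts to the unit tensor on the
  -- block set (keep the `(0,0)` entry of each block; Bläser 2013 §7)
  have hunit : ∀ {p : ℕ} (k m n : Fin p → ℕ), (∀ i, 0 < k i) → (∀ i, 0 < m i) → (∀ i, 0 < n i) →
      TensorRestrictsTo (matMulDirectSum ℂ k m n) (unitTensor ℂ p) := by
    intro p k m n hk hm hn
    have e : unitTensor ℂ p = fun a b c => matMulDirectSum ℂ k m n
        ⟨a, (⟨0, hk a⟩, ⟨0, hn a⟩)⟩ ⟨b, (⟨0, hk b⟩, ⟨0, hm b⟩)⟩ ⟨c, (⟨0, hm c⟩, ⟨0, hn c⟩)⟩ := by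
      funext a b c
      simp [unitTensor_apply, matMulDirectSum]
    rw [e]
    exact tensorRestrictsTo_precomp _ _ _ _
  refine h1.trans (hunit _ _ _ ?_ ?_ ?_) <;>
    · intro i
      simp

/-- **Combinatorial layer** (Le Gall A.3 effective, tree `exists_free_diagonal_jointType_card` with
`S = S₃`, `b = 2`, tightness `i + j + (l−3) = 0`, uniform joint type `Q ≡ M` on `S₃`, `N = 6M`):
a free diagonal `Δ ⊆ (S₃)^N` of one joint type with
`2^{N (min_m H(P_m) − Γ_S(P))} ≤ |Δ| · (N+1)^63 · 192 · exp(4 √(log 6 + N log 27))`.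
[cite: LeGall2014, Appendix A.3, Eq. (7) and p. 24] -/
theorem permDiagonalRaw (M : ℕ) (hM : 1 ≤ M) (P : Fin 3 × Fin 3 × Fin 3 → ℝ)
    (hP : ∀ s, P s = ((if s ∈ permSupport₃ then M else 0 : ℕ) : ℝ) / (((6 * M : ℕ)) : ℝ)) :
    ∃ Δ : Finset ((Fin (6 * M) → Fin 3) × (Fin (6 * M) → Fin 3) × (Fin (6 * M) → Fin 3)),
      (∀ δ ∈ Δ, ∀ ρ, labelSeq δ ρ ∈ permSupport₃) ∧
      (∀ δ ∈ Δ, ∀ δ' ∈ Δ, ∀ δ'' ∈ Δ, (∀ ρ, (δ.1 ρ, δ'.2.1 ρ, δ''.2.2 ρ) ∈ permSupport₃) →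
          δ = δ' ∧ δ' = δ'') ∧
      (2 : ℝ) ^ ((((6 * M : ℕ)) : ℝ) *
          (min (shannonEntropy (marginalDist₁ P))
            (min (shannonEntropy (marginalDist₂ P)) (shannonEntropy (marginalDist₃ P))) -
            maxEntropyPenalty permSupport₃ P)) ≤
        (Δ.card : ℝ) * ((((6 * M : ℕ)) : ℝ) + 1) ^ 63 * 192 *
          Real.exp (4 * Real.sqrt (Real.log 6 + (((6 * M : ℕ)) : ℝ) * Real.log 27)) := by
  classical
  have hinj : Function.Injective fun (i : Fin 3) (_ : Fin 1) => (i : ℤ) := by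
    intro i i' h
    have h0 := congrFun h 0
    simp only [Nat.cast_inj] at h0
    exact Fin.ext h0
  have hinjγ : Function.Injective fun (l : Fin 3) (_ : Fin 1) => (l : ℤ) - 3 := by
    intro l l' h
    have h0 := congrFun h 0
    simp only [sub_left_inj, Nat.cast_inj] at h0
    exact Fin.ext h0
  have hbd : ∀ (i : Fin 3) (ρ : Fin 1), |((fun (i : Fin 3) (_ : Fin 1) => (i : ℤ)) i ρ)| ≤ (2 : ℕ) := by
    intro i ρ
    have := i.isLt
    simp only [Nat.cast_ofNat, Nat.abs_cast]
    omega
  have htight : ∀ s ∈ permSupport₃, ∀ ρ : Fin 1,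
      (fun (i : Fin 3) (_ : Fin 1) => (i : ℤ)) s.1 ρ + (fun (j : Fin 3) (_ : Fin 1) => (j : ℤ)) s.2.1 ρ +
        (fun (l : Fin 3) (_ : Fin 1) => (l : ℤ) - 3) s.2.2 ρ = 0 := by
    intro s hs ρ
    exact tight_of_mem_permSupport₃ hs
  obtain ⟨Q, hQdef⟩ : ∃ Q : Fin 3 × Fin 3 × Fin 3 → ℕ, Q = fun s =>
      if s ∈ permSupport₃ then M else 0 := ⟨_, rfl⟩
  have hN : 0 < 6 * M := by omega
  have hQS : ∀ s, s ∉ permSupport₃ → Q s = 0 := by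
    intro s hs
    simp [hQdef, hs]
  have hQ : ∑ s, Q s = 6 * M := by
    rw [hQdef, Finset.sum_ite_mem, Finset.univ_inter, Finset.sum_const, permSupport₃_card,
      smul_eq_mul]
  have hP' : ∀ s, P s = (Q s : ℝ) / (((6 * M : ℕ)) : ℝ) := by
    intro s
    rw [hQdef]
    exact hP s
  obtain ⟨Δ, hΔQ, hfree, hsize⟩ := exists_free_diagonal_jointType_card permSupport₃ (r := 1) (b := 2)
    (fun (i : Fin 3) (_ : Fin 1) => (i : ℤ)) (fun (j : Fin 3) (_ : Fin 1) => (j : ℤ))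
    (fun (l : Fin 3) (_ : Fin 1) => (l : ℤ) - 3) hinj hinj hinjγ hbd hbd htight hN Q hQS hQ P hP'
  have hQδ : ∀ δ ∈ Δ, letterCount (labelSeq δ) = Q := fun δ hδ => (Finset.mem_filter.1 (hΔQ hδ)).2
  refine ⟨Δ, ?_, hfree, ?_⟩
  · intro δ hδ ρ
    by_contra hρ
    have h0 := hQS _ hρ
    rw [← hQδ δ hδ] at h0
    exact (letterCount_pos_of_apply (labelSeq δ) ρ).ne' h0
  · refine hsize.trans_eq ?_
    have hmax : (max 2 1 : ℕ) = 2 := by decide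
    generalize (((6 * M : ℕ)) : ℝ) = Nr
    simp only [Fintype.card_prod, Fintype.card_fin, hmax]
    norm_num
    simp only [mul_assoc]

/-- The law `P = 1/6 · 𝟙_{S₃}` has the three uniform marginals `(1/3,1/3,1/3)`. [folklore] -/
theorem marginalDist_perm {P : Fin 3 × Fin 3 × Fin 3 → ℝ}
    (hP : ∀ s, P s = if s ∈ permSupport₃ then 1 / 6 else 0) :
    marginalDist₁ P = (fun _ => 1 / 3) ∧ marginalDist₂ P = (fun _ => 1 / 3) ∧
      marginalDist₃ P = (fun _ => 1 / 3) := by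
  refine ⟨?_, ?_, ?_⟩ <;> funext i <;> fin_cases i <;>
    simp [marginalDist₁, marginalDist₂, marginalDist₃, Fin.sum_univ_three, hP, mem_permSupport₃] <;>
    norm_num

/-- **The penalty vanishes EXACTLY**: `Γ_{S₃}(P) = 0` for the uniform law on `S₃` — it is its own
entropy maximiser among the laws on `S₃` with its marginals (Lagrange condition of VXXZ §8 with
`λ_X = λ_Y = λ_Z = 0`; tree `maxEntropyPenalty_eq_of_lagrange`). [cite: VassilevskaWilliamsXuXuZhou2024, §8] -/
theorem maxEntropyPenalty_perm_eq_zero {P : Fin 3 × Fin 3 × Fin 3 → ℝ}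
    (hP : ∀ s, P s = if s ∈ permSupport₃ then 1 / 6 else 0) :
    maxEntropyPenalty permSupport₃ P = 0 := by
  classical
  have hsimplex : P ∈ stdSimplex ℝ (Fin 3 × Fin 3 × Fin 3) := by
    refine ⟨fun s => ?_, ?_⟩
    · rw [hP]
      split_ifs <;> norm_num
    · simp_rw [hP]
      rw [Finset.sum_ite_mem, Finset.univ_inter, Finset.sum_const, permSupport₃_card, nsmul_eq_mul]
      norm_num
  have hsupp : ∀ x, x ∉ permSupport₃ → P x = 0 := fun x hx => by rw [hP, if_neg hx]
  have hlag : ∀ x ∈ permSupport₃,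
      Real.exp ((fun _ : Fin 3 => (0 : ℝ)) x.1 + (fun _ : Fin 3 => (0 : ℝ)) x.2.1 +
        (fun _ : Fin 3 => (0 : ℝ)) x.2.2 + (1 + Real.log (1 / 6)) - 1) = P x := by
    intro x hx
    rw [hP, if_pos hx]
    simp only [zero_add, add_sub_cancel_left]
    exact Real.exp_log (by norm_num)
  rw [maxEntropyPenalty_eq_of_lagrange (lX := fun _ : Fin 3 => (0 : ℝ)) (lY := fun _ : Fin 3 => (0 : ℝ))
    (lZ := fun _ : Fin 3 => (0 : ℝ)) (lS := 1 + Real.log (1 / 6))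
    (self_mem_sameMarginalsOn hsimplex hsupp) hlag, sub_self]

/-- **`cw₂^{⊠6M} ≥ ⟨r⟩` with `3^{6M} ≤ r · (N+1)^63 · 192 · exp(4√(log 6 + N log 27))`, `N = 6M`**
(the three layers: `cw₂ ≥ cw'₂`, the free diagonal of the uniform type on `S₃`, entropy `log₂3`,
penalty `0`). [cite: LeGall2014, Appendix A.3] -/
theorem cwTwoDiagonal (M : ℕ) (hM : 1 ≤ M) :
    ∃ r : ℕ, TensorRestrictsTo (kroneckerPow (cwTensor ℂ 2) (6 * M)) (unitTensor ℂ r) ∧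
      (3 : ℝ) ^ (6 * M) ≤ (r : ℝ) * (((((6 * M : ℕ)) : ℝ) + 1) ^ 63 * 192 *
        Real.exp (4 * Real.sqrt (Real.log 6 + (((6 * M : ℕ)) : ℝ) * Real.log 27))) := by
  classical
  set P : Fin 3 × Fin 3 × Fin 3 → ℝ := fun s =>
    ((if s ∈ permSupport₃ then M else 0 : ℕ) : ℝ) / (((6 * M : ℕ)) : ℝ) with hPdef
  have hPs : ∀ s, P s = ((if s ∈ permSupport₃ then M else 0 : ℕ) : ℝ) / (((6 * M : ℕ)) : ℝ) :=
    fun s => rfl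
  obtain ⟨Δ, hS, hfree, hsize⟩ := permDiagonalRaw M hM P hPs
  -- the law as probabilities
  have hM0 : (M : ℝ) ≠ 0 := by exact_mod_cast (by omega : M ≠ 0)
  have hPp : ∀ s, P s = if s ∈ permSupport₃ then 1 / 6 else 0 := by
    intro s
    rw [hPs s]
    push_cast
    split_ifs
    · rw [div_eq_iff (by positivity)]
      ring
    · simp
  obtain ⟨hm₁, hm₂, hm₃⟩ := marginalDist_perm hPp
  have hpen := maxEntropyPenalty_perm_eq_zero hPp
  refine ⟨Δ.card, (tensorRestrictsTo_cwTensor_two_cwPrime.kroneckerPow (6 * M)).trans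
    (tensorRestrictsTo_kroneckerPow_cwPrime_unitTensor Δ hS hfree), ?_⟩
  -- `H(1/3,1/3,1/3) = log₂ 3`
  have shannonEntropy_uniform_three :
      shannonEntropy (fun _ : Fin 3 => (1 : ℝ) / 3) = Real.log 3 / Real.log 2 := by
    rw [shannonEntropy_def, Finset.sum_const, Finset.card_univ, Fintype.card_fin, nsmul_eq_mul]
    congr 1
    rw [Real.negMulLog, one_div, Real.log_inv]
    push_cast
    ring
  rw [hm₁, hm₂, hm₃, shannonEntropy_uniform_three, min_self, min_self, hpen, sub_zero] at hsize
  have e : (2 : ℝ) ^ ((((6 * M : ℕ)) : ℝ) * (Real.log 3 / Real.log 2)) = (3 : ℝ) ^ (6 * M) := by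
    have hlog2 : Real.log 2 ≠ 0 := (Real.log_pos one_lt_two).ne'
    rw [Real.rpow_def_of_pos two_pos, show Real.log 2 * ((((6 * M : ℕ)) : ℝ) * (Real.log 3 / Real.log 2))
        = (((6 * M : ℕ)) : ℝ) * Real.log 3 by field_simp, ← Real.log_pow,
      Real.exp_log (by positivity)]
  rw [e] at hsize
  linarith [hsize]

/-- **THEOREM (kernel, ω-free): `DiagonalAchieved`** — `cw₂^{⊠N} ≥ ⟨3^{(1−ε)N}⟩` for infinitely
many `N` (all large multiples of `6`).  Hence `summit_iff'` below is EXACT with no print anchor.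
[cite: LeGall2014, Appendix A.3] [cite: CoppersmithWinograd1990, §11] -/
theorem diagonalAchieved : ∀ ε : ℝ, 0 < ε → ∀ N₀ : ℕ, ∃ N : ℕ, N₀ ≤ N ∧ ∃ r : ℕ,
    TensorRestrictsTo (kroneckerPow (cwTensor ℂ 2) N) (unitTensor ℂ r) ∧
      (3 : ℝ) ^ ((1 - ε) * N) ≤ (r : ℝ) := by
  intro ε hε N₀
  have hκ : 0 < 6 * ε * Real.log 3 := by positivity [Real.log_pos (by norm_num : (1 : ℝ) < 3)]
  obtain ⟨m₀, hm₀⟩ := exists_nat_forall_sqrt_le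
    (126 * √((4 : ℝ) + 3) + 4 * √(Real.log 6 + ((4 : ℝ) + 2) * Real.log 27)) (Real.log 192)
    (6 * ε * Real.log 3) hκ
  set M : ℕ := max (max m₀ N₀) 1 with hMdef
  have hM1 : 1 ≤ M := le_max_right _ _
  have hMm₀ : m₀ ≤ M := (le_max_left _ _).trans (le_max_left _ _)
  have hMN₀ : N₀ ≤ M := (le_max_right _ _).trans (le_max_left _ _)
  obtain ⟨r, hres, hsize⟩ := cwTwoDiagonal M hM1
  refine ⟨6 * M, by omega, r, hres, ?_⟩
  have hMr : (1 : ℝ) ≤ M := by exact_mod_cast hM1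
  have hloss := SaturationLadderExpSaturation.loss_le_exp' (by norm_num : (0 : ℝ) ≤ 4) hMr (hm₀ M hMm₀)
  have hN : (((6 * M : ℕ)) : ℝ) = ((4 : ℝ) + 2) * M := by push_cast; ring
  rw [hN] at hsize
  -- `3^{6M} ≤ r · exp(6 ε M log 3)`, i.e. `3^{(1−ε)·6M} ≤ r`
  have hr0 : (0 : ℝ) ≤ r := Nat.cast_nonneg r
  have h1 : (3 : ℝ) ^ (6 * M) ≤ (r : ℝ) * Real.exp (6 * ε * Real.log 3 * M) :=
    hsize.trans (mul_le_mul_of_nonneg_left hloss hr0)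
  have e3 : (3 : ℝ) ^ (6 * M) = Real.exp ((6 * M : ℝ) * Real.log 3) := by
    rw [← Real.exp_log (by positivity : (0 : ℝ) < 3 ^ (6 * M)), Real.log_pow]
    push_cast
    ring_nf
  have e1 : (3 : ℝ) ^ ((1 - ε) * ((6 * M : ℕ) : ℝ)) =
      Real.exp ((6 * M : ℝ) * Real.log 3) / Real.exp (6 * ε * Real.log 3 * M) := by
    rw [Real.rpow_def_of_pos (by norm_num : (0 : ℝ) < 3), ← Real.exp_sub]
    congr 1
    push_cast
    ring
  rw [e1, div_le_iff₀ (Real.exp_pos _), ← e3]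
  exact h1

end Summit.MatrixMultiplication.MatrixMultiplication.Theorems.OutsiderSandwichHalfMM
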